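import Summits.CriticalPhenomena.PercolationContinuityZ3.Theorems.PercNearOneGluingNoHeavyLowerTailKnQuestion8CoefficientwisePointLocality
import HarnessLib

/-!
# The ROOT-SECTOR IDENTITY of the point row at a root of degree two (prim-lf-2 gen 37/38)

Support file (`--supports stmt-CriticalPhenomena-4575`, closed), prover `prim-lf-2` (gen 38).  No definitions, no named facts, no sorries; standard axioms.
Memos `prim-lf-2/CW-SECTORS-gen37.md` (§0(i), §1) and `prim-lf-2/CW-ZONES-gen38.md`; notation of `prim-lf-2/CW-POINTS-gen32.md`.

For a multigraph `ends : ι → Sym2 V` on an edge set `E`, root `x`, wall SET `Z`, colouring `s ⊔ (E ∖ s)`, `K s = C_x(s)` (red cluster), `K (E ∖ s)` (blue),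
`W_E = {s ⊆ E : ∀ z ∈ Z, z ∉ K s ∧ z ∉ K (E ∖ s)}`, `σ_v(s) = 1[v ∈ K s] − 1[v ∈ K (E ∖ s)]`; the POINT ROW of CW-PA is `0 ≤ Σ_{W_E} σ_u σ_w` (CW-POINTS-gen32;
it follows from PRIME POSITIVITY by gen 36's island factorisation, `Coefficientwise.pointRow_nonneg_of_prime_nonneg`).  SECTOR DECOMPOSITION at a root of
degree two: if the only edges of `E` at `x` are `e₁ = {x,p}`, `e₂ = {x,q}` and `E' = E ∖ {e₁,e₂}` (the edges of `H = G − x`), then resolving the colours of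
`e₁, e₂`, a colouring `t ⊆ E'` has `K = {x} ∪ C_p(t) ∪ C_q(t)`, `K̄ = {x}` in the pure sector and `K = {x} ∪ C_p(t)`, `K̄ = {x} ∪ C_q(E' ∖ t)` in the mixed
sector; the two pure (resp. mixed) sectors agree under `t ↦ E' ∖ t`.  Hence `Σ_{W_E} σ_u σ_w = 2·N_pure + 2·M` with
`N_pure = #{t ⊆ E' : u, w ∈ C_p(t) ∪ C_q(t) ∌ Z}` (red cluster of the SET `{p,q}` in `H`) and
`M = Σ_{t ⊆ E' : Z ∩ (C_p(t) ∪ C_q(E'∖t)) = ∅} (1[u ∈ C_p t] − 1[u ∈ C_q(E'∖t)])(1[w ∈ C_p t] − 1[w ∈ C_q(E'∖t)])` (= #concordant − #crossing of the mixed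
sector, red cluster of `p` against blue cluster of `q`): the point row at a degree-two root is EXACTLY the two-source inequality `N_pure + M ≥ 0` on `H`
(CW-SECTORS-gen37 §0(i), §1) — the statement the gen-37/38 censuses test.
* `Coefficientwise.mem_openCluster_iff_eq_of_rootless` — no edge of `t` at `x` ⇒ `C_x(t) = {x}`.
* `Coefficientwise.mem_openCluster_insert_rootEdge_iff` — `C_x(t ∪ {e}) = {x} ∪ C_p(t)` when `e = {x,p}` and no edge of `t` contains `x`.
* `Coefficientwise.mem_openCluster_insert_two_rootEdges_iff` — `C_x(t ∪ {e₁,e₂}) = {x} ∪ C_p(t) ∪ C_q(t)`.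
* `Coefficientwise.pointRow_rootDegTwo_eq` — **THE SECTOR IDENTITY** `Σ_{W_E} σ_u σ_w = 2·N_pure + 2·M`.
* `Coefficientwise.pointRow_nonneg_of_rootDegTwo` — COROLLARY: `0 ≤ N_pure + M` on `H` implies the point row of `G` at `x`.
[cite: KozmaNitzan2024, Questions 8–9 (§5.5 p. 36) (context: the Question-8 pocket covariance programme)]
-/

namespace Summit.CriticalPhenomena.PercolationContinuityZ3.Theorems

open Finset Literature.Probability.Percolation

namespace Coefficientwise

variable {ι V : Type*} (ends : ι → Sym2 V)

section clusters

variable [DecidableEq ι]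

omit [DecidableEq ι] in
/-- If no edge of `t` contains `x`, the cluster of `x` is `{x}`. [cite: KozmaNitzan2024, §5.5 (context only; folklore)] -/
theorem mem_openCluster_iff_eq_of_rootless {t : Finset ι} {x v : V} (ht : ∀ i ∈ t, x ∉ ends i) :
    v ∈ openCluster (ends '' (↑t : Set ι)) x ↔ v = x := by
  constructor
  · intro hv
    by_contra hvx
    have hxv : x ∈ openCluster (ends '' (↑t : Set ι)) v := SimpleGraph.Reachable.symm hv
    exact not_mem_openCluster_of_forall_not_mem ends (s := t) ht (fun h => hvx h.symm) hxv
  · intro h; rw [h]; exact mem_openCluster_self _ _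

/-- **One root edge.**  If `e = {x, p}` and no edge of `t` contains `x`, then `C_x(t ∪ {e}) = {x} ∪ C_p(t)`.
[cite: KozmaNitzan2024, §5.5 (context only; folklore)] -/
theorem mem_openCluster_insert_rootEdge_iff {t : Finset ι} {x p v : V} {e : ι} (he : ends e = s(x, p))
    (ht : ∀ i ∈ t, x ∉ ends i) :
    v ∈ openCluster (ends '' (↑(insert e t) : Set ι)) x ↔ (v = x ∨ v ∈ openCluster (ends '' (↑t : Set ι)) p) := by
  constructor
  · intro hv
    obtain ⟨walk⟩ := hv
    have htr : ∀ a ∈ ({y | y = x ∨ y ∈ openCluster (ends '' (↑t : Set ι)) p} : Set V), ∀ b,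
        (openGraph (ends '' (↑(insert e t) : Set ι))).Adj a b →
        (openGraph (ends '' (↑(insert e t) : Set ι))).Adj a b ∧ b ∈ ({y | y = x ∨ y ∈ openCluster (ends '' (↑t : Set ι)) p} : Set V) := by
      intro a ha b hadj
      refine ⟨hadj, ?_⟩
      have ha' : a = x ∨ a ∈ openCluster (ends '' (↑t : Set ι)) p := ha
      rw [openGraph_image_adj] at hadj
      obtain ⟨⟨i, hit, hi⟩, _⟩ := hadj
      rcases Finset.mem_insert.mp hit with hie | hit'
      · have hb : b ∈ s(x, p) := by rw [← he, ← hie, hi]; exact Sym2.mem_mk_right a b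
        rcases Sym2.mem_iff.mp hb with hbx | hbp
        · exact Or.inl hbx
        · rw [hbp]; exact Or.inr (mem_openCluster_self _ _)
      · have hax : a ≠ x := fun hax => ht i hit' (by rw [hi, hax]; exact Sym2.mem_mk_left x b)
        rcases ha' with hax' | haC
        · exact absurd hax' hax
        · exact Or.inr (mem_openCluster_of_edge ends hit' hi haC)
    exact ((reachable_transfer _ htr walk) (Or.inl rfl)).2
  · rintro (h | hv)
    · rw [h]; exact mem_openCluster_self _ _
    · have hxp : (openGraph (ends '' (↑(insert e t) : Set ι))).Reachable x p := by
        by_cases hpx : p = x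
        · rw [hpx]
        · have hadj : (openGraph (ends '' (↑(insert e t) : Set ι))).Adj x p := by
            rw [openGraph_image_adj]
            exact ⟨⟨e, Finset.mem_insert_self e t, he⟩, fun h => hpx h.symm⟩
          exact hadj.reachable
      exact SimpleGraph.Reachable.trans hxp (openCluster_image_mono ends (Finset.subset_insert e t) p hv)

/-- **Two root edges.**  If `e₁ = {x, p}`, `e₂ = {x, q}` and no edge of `t` contains `x`, then `C_x(t ∪ {e₁, e₂}) = {x} ∪ C_p(t) ∪ C_q(t)`.
[cite: KozmaNitzan2024, §5.5 (context only; folklore)] -/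
theorem mem_openCluster_insert_two_rootEdges_iff {t : Finset ι} {x p q v : V} {e₁ e₂ : ι} (h₁ : ends e₁ = s(x, p)) (h₂ : ends e₂ = s(x, q))
    (ht : ∀ i ∈ t, x ∉ ends i) :
    v ∈ openCluster (ends '' (↑(insert e₁ (insert e₂ t)) : Set ι)) x ↔
      (v = x ∨ v ∈ openCluster (ends '' (↑t : Set ι)) p ∨ v ∈ openCluster (ends '' (↑t : Set ι)) q) := by
  constructor
  · intro hv
    obtain ⟨walk⟩ := hv
    have htr : ∀ a ∈ ({y | y = x ∨ y ∈ openCluster (ends '' (↑t : Set ι)) p ∨ y ∈ openCluster (ends '' (↑t : Set ι)) q} : Set V), ∀ b,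
        (openGraph (ends '' (↑(insert e₁ (insert e₂ t)) : Set ι))).Adj a b →
        (openGraph (ends '' (↑(insert e₁ (insert e₂ t)) : Set ι))).Adj a b ∧
          b ∈ ({y | y = x ∨ y ∈ openCluster (ends '' (↑t : Set ι)) p ∨ y ∈ openCluster (ends '' (↑t : Set ι)) q} : Set V) := by
      intro a ha b hadj
      refine ⟨hadj, ?_⟩
      have ha' : a = x ∨ a ∈ openCluster (ends '' (↑t : Set ι)) p ∨ a ∈ openCluster (ends '' (↑t : Set ι)) q := ha
      rw [openGraph_image_adj] at hadj
      obtain ⟨⟨i, hit, hi⟩, _⟩ := hadj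
      rcases Finset.mem_insert.mp hit with hie | hit₂
      · have hb : b ∈ s(x, p) := by rw [← h₁, ← hie, hi]; exact Sym2.mem_mk_right a b
        rcases Sym2.mem_iff.mp hb with hbx | hbp
        · exact Or.inl hbx
        · rw [hbp]; exact Or.inr (Or.inl (mem_openCluster_self _ _))
      rcases Finset.mem_insert.mp hit₂ with hie | hit'
      · have hb : b ∈ s(x, q) := by rw [← h₂, ← hie, hi]; exact Sym2.mem_mk_right a b
        rcases Sym2.mem_iff.mp hb with hbx | hbq
        · exact Or.inl hbx
        · rw [hbq]; exact Or.inr (Or.inr (mem_openCluster_self _ _))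
      · have hax : a ≠ x := by
          intro hax
          apply ht i hit'
          rw [hi, hax]
          exact Sym2.mem_mk_left x b
        rcases ha' with hax' | haC | haC
        · exact absurd hax' hax
        · exact Or.inr (Or.inl (mem_openCluster_of_edge ends hit' hi haC))
        · exact Or.inr (Or.inr (mem_openCluster_of_edge ends hit' hi haC))
    exact ((reachable_transfer _ htr walk) (Or.inl rfl)).2
  · have hsub : t ⊆ insert e₁ (insert e₂ t) := fun i hi => Finset.mem_insert_of_mem (Finset.mem_insert_of_mem hi)
    rintro (h | hv | hv)
    · rw [h]; exact mem_openCluster_self _ _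
    · have hxp : (openGraph (ends '' (↑(insert e₁ (insert e₂ t)) : Set ι))).Reachable x p := by
        by_cases hpx : p = x
        · rw [hpx]
        · have hadj : (openGraph (ends '' (↑(insert e₁ (insert e₂ t)) : Set ι))).Adj x p := by
            rw [openGraph_image_adj]
            exact ⟨⟨e₁, Finset.mem_insert_self e₁ _, h₁⟩, fun h => hpx h.symm⟩
          exact hadj.reachable
      exact SimpleGraph.Reachable.trans hxp (openCluster_image_mono ends hsub p hv)
    · have hxq : (openGraph (ends '' (↑(insert e₁ (insert e₂ t)) : Set ι))).Reachable x q := by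
        by_cases hqx : q = x
        · rw [hqx]
        · have hadj : (openGraph (ends '' (↑(insert e₁ (insert e₂ t)) : Set ι))).Adj x q := by
            rw [openGraph_image_adj]
            exact ⟨⟨e₂, Finset.mem_insert_of_mem (Finset.mem_insert_self e₂ t), h₂⟩, fun h => hqx h.symm⟩
          exact hadj.reachable
      exact SimpleGraph.Reachable.trans hxq (openCluster_image_mono ends hsub q hv)

end clusters

section sums

variable [DecidableEq ι]

open Classical in
/-- **THE ROOT-SECTOR IDENTITY AT A ROOT OF DEGREE TWO** (prim-lf-2 gen 37, CW-SECTORS-gen37 §0(i); kernel form gen 38).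
Let the only edges of `E` at `x` be `e₁ ≠ e₂` with ends `{x,p}`, `{x,q}`, `E' = (E.erase e₁).erase e₂`, `u, w ≠ x`, `x ∉ Z`.  Then
`Σ_{s ⊆ E : ∀ z ∈ Z, z ∉ C_x(s), z ∉ C_x(E∖s)} σ_u(s) σ_w(s) = 2·N_pure + 2·M` with
`N_pure = Σ_{t ⊆ E' : ∀ z ∈ Z, z ∉ C_p(t), z ∉ C_q(t)} 1[u ∈ C_p(t) ∪ C_q(t)]·1[w ∈ C_p(t) ∪ C_q(t)]` (pure sector: red cluster of `{p,q}` in `H = G − x`) and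
`M = Σ_{t ⊆ E' : ∀ z ∈ Z, z ∉ C_p(t), z ∉ C_q(E'∖t)} (1[u ∈ C_p t] − 1[u ∈ C_q(E'∖t)])·(1[w ∈ C_p t] − 1[w ∈ C_q(E'∖t)])` (mixed sector: red cluster of
`p` against blue cluster of `q` in `H`).  [cite: KozmaNitzan2024, Questions 8–9 (§5.5 p. 36) (context)] -/
theorem pointRow_rootDegTwo_eq (E : Finset ι) {x p q : V} {e₁ e₂ : ι} (he₁ : e₁ ∈ E) (he₂ : e₂ ∈ E) (hne : e₁ ≠ e₂)
    (h₁ : ends e₁ = s(x, p)) (h₂ : ends e₂ = s(x, q)) (hroot : ∀ i ∈ E, x ∈ ends i → i = e₁ ∨ i = e₂)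
    (u w : V) (hux : u ≠ x) (hwx : w ≠ x) (Z : Set V) (hxZ : x ∉ Z) :
    ∑ s ∈ E.powerset.filter (fun s : Finset ι => ∀ z ∈ Z, z ∉ openCluster (ends '' (↑(s) : Set ι)) x ∧ z ∉ openCluster (ends '' (↑(E \ s) : Set ι)) x),
      ((if u ∈ openCluster (ends '' (↑(s) : Set ι)) x then (1 : ℝ) else 0) - (if u ∈ openCluster (ends '' (↑(E \ s) : Set ι)) x then (1 : ℝ) else 0)) *
        ((if w ∈ openCluster (ends '' (↑(s) : Set ι)) x then (1 : ℝ) else 0) - (if w ∈ openCluster (ends '' (↑(E \ s) : Set ι)) x then (1 : ℝ) else 0)) =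
    2 * (∑ t ∈ ((E.erase e₁).erase e₂).powerset.filter (fun t : Finset ι => ∀ z ∈ Z,
          z ∉ openCluster (ends '' (↑(t) : Set ι)) p ∧ z ∉ openCluster (ends '' (↑(t) : Set ι)) q),
      (if (u ∈ openCluster (ends '' (↑(t) : Set ι)) p ∨ u ∈ openCluster (ends '' (↑(t) : Set ι)) q) then (1 : ℝ) else 0) *
        (if (w ∈ openCluster (ends '' (↑(t) : Set ι)) p ∨ w ∈ openCluster (ends '' (↑(t) : Set ι)) q) then (1 : ℝ) else 0)) +
    2 * (∑ t ∈ ((E.erase e₁).erase e₂).powerset.filter (fun t : Finset ι => ∀ z ∈ Z,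
          z ∉ openCluster (ends '' (↑(t) : Set ι)) p ∧ z ∉ openCluster (ends '' (↑(((E.erase e₁).erase e₂) \ t) : Set ι)) q),
      ((if u ∈ openCluster (ends '' (↑(t) : Set ι)) p then (1 : ℝ) else 0) -
          (if u ∈ openCluster (ends '' (↑(((E.erase e₁).erase e₂) \ t) : Set ι)) q then (1 : ℝ) else 0)) *
        ((if w ∈ openCluster (ends '' (↑(t) : Set ι)) p then (1 : ℝ) else 0) -
          (if w ∈ openCluster (ends '' (↑(((E.erase e₁).erase e₂) \ t) : Set ι)) q then (1 : ℝ) else 0))) := by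
  set E' : Finset ι := (E.erase e₁).erase e₂ with hE'
  have he₁E' : e₁ ∉ E' := fun h => Finset.notMem_erase e₁ E (Finset.mem_of_mem_erase h)
  have he₂E' : e₂ ∉ E' := Finset.notMem_erase e₂ _
  have he₁E'' : e₁ ∉ insert e₂ E' := by rw [Finset.mem_insert]; rintro (h | h); exacts [hne h, he₁E' h]
  have hE : E = insert e₁ (insert e₂ E') := by
    rw [hE', Finset.insert_erase (Finset.mem_erase.mpr ⟨fun h => hne h.symm, he₂⟩), Finset.insert_erase he₁]
  -- edges of `E'` avoid `x`
  have hE'x : ∀ i ∈ E', x ∉ ends i := by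
    intro i hi hxi
    have hiE : i ∈ E := Finset.mem_of_mem_erase (Finset.mem_of_mem_erase hi)
    rcases hroot i hiE hxi with hi1 | hi2
    · exact he₁E' (hi1 ▸ hi)
    · exact he₂E' (hi2 ▸ hi)
  have htx : ∀ t : Finset ι, t ⊆ E' → ∀ i ∈ t, x ∉ ends i := fun t ht i hi => hE'x i (ht hi)
  have hsd : ∀ t : Finset ι, E' \ t ⊆ E' := fun t => Finset.sdiff_subset; have hZx : ∀ z ∈ Z, z ≠ x := fun z hz hzx => hxZ (hzx ▸ hz)
  -- complements inside `E = insert e₁ (insert e₂ E')`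
  have cRR : ∀ t, t ⊆ E' → (insert e₁ (insert e₂ E')) \ (insert e₁ (insert e₂ t)) = E' \ t := by
    intro t ht; ext i
    simp only [Finset.mem_sdiff, Finset.mem_insert, not_or]
    constructor
    · rintro ⟨h1, h2, h3, h4⟩
      rcases h1 with h1 | h1 | h1
      · exact absurd h1 h2
      · exact absurd h1 h3
      · exact ⟨h1, h4⟩
    · rintro ⟨h1, h2⟩
      exact ⟨Or.inr (Or.inr h1), fun h => he₁E' (h ▸ h1), fun h => he₂E' (h ▸ h1), h2⟩
  have cBB : ∀ t, t ⊆ E' → (insert e₁ (insert e₂ E')) \ t = insert e₁ (insert e₂ (E' \ t)) := by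
    intro t ht; ext i
    simp only [Finset.mem_sdiff, Finset.mem_insert]
    constructor
    · rintro ⟨h1, h2⟩
      rcases h1 with h1 | h1 | h1
      · exact Or.inl h1
      · exact Or.inr (Or.inl h1)
      · exact Or.inr (Or.inr ⟨h1, h2⟩)
    · rintro (h1 | h1 | ⟨h1, h2⟩)
      · exact ⟨Or.inl h1, fun h => he₁E' (ht (h1 ▸ h))⟩
      · exact ⟨Or.inr (Or.inl h1), fun h => he₂E' (ht (h1 ▸ h))⟩
      · exact ⟨Or.inr (Or.inr h1), h2⟩
  have cRB : ∀ t, t ⊆ E' → (insert e₁ (insert e₂ E')) \ (insert e₁ t) = insert e₂ (E' \ t) := by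
    intro t ht; ext i
    simp only [Finset.mem_sdiff, Finset.mem_insert, not_or]
    constructor
    · rintro ⟨h1, h2, h3⟩
      rcases h1 with h1 | h1 | h1
      · exact absurd h1 h2
      · exact Or.inl h1
      · exact Or.inr ⟨h1, h3⟩
    · rintro (h1 | ⟨h1, h2⟩)
      · exact ⟨Or.inr (Or.inl h1), fun h => hne (h.symm.trans h1), fun h => he₂E' (ht (h1 ▸ h))⟩
      · exact ⟨Or.inr (Or.inr h1), fun h => he₁E' (h ▸ h1), h2⟩
  have cBR : ∀ t, t ⊆ E' → (insert e₁ (insert e₂ E')) \ (insert e₂ t) = insert e₁ (E' \ t) := by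
    intro t ht; ext i
    simp only [Finset.mem_sdiff, Finset.mem_insert, not_or]
    constructor
    · rintro ⟨h1, h2, h3⟩
      rcases h1 with h1 | h1 | h1
      · exact Or.inl h1
      · exact absurd h1 h2
      · exact Or.inr ⟨h1, h3⟩
    · rintro (h1 | ⟨h1, h2⟩)
      · exact ⟨Or.inl h1, fun h => hne (h1.symm.trans h), fun h => he₁E' (ht (h1 ▸ h))⟩
      · exact ⟨Or.inr (Or.inr h1), fun h => he₂E' (h ▸ h1), h2⟩
  -- cluster memberships in the sectors, for vertices other than `x`
  have kRR : ∀ t, t ⊆ E' → ∀ v, v ≠ x → (v ∈ openCluster (ends '' (↑(insert e₁ (insert e₂ t)) : Set ι)) x ↔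
      (v ∈ openCluster (ends '' (↑(t) : Set ι)) p ∨ v ∈ openCluster (ends '' (↑(t) : Set ι)) q)) := by
    intro t ht v hv
    rw [mem_openCluster_insert_two_rootEdges_iff ends h₁ h₂ (htx t ht)]
    exact ⟨fun h => h.resolve_left hv, fun h => Or.inr h⟩
  have k0 : ∀ t, t ⊆ E' → ∀ v, v ≠ x → ¬ v ∈ openCluster (ends '' (↑(t) : Set ι)) x := by
    intro t ht v hv h
    exact hv ((mem_openCluster_iff_eq_of_rootless ends (htx t ht)).mp h)
  have kR : ∀ t, t ⊆ E' → ∀ v, v ≠ x → (v ∈ openCluster (ends '' (↑(insert e₁ t) : Set ι)) x ↔ v ∈ openCluster (ends '' (↑(t) : Set ι)) p) := by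
    intro t ht v hv
    rw [mem_openCluster_insert_rootEdge_iff ends h₁ (htx t ht)]
    exact ⟨fun h => h.resolve_left hv, fun h => Or.inr h⟩
  have kB : ∀ t, t ⊆ E' → ∀ v, v ≠ x → (v ∈ openCluster (ends '' (↑(insert e₂ t) : Set ι)) x ↔ v ∈ openCluster (ends '' (↑(t) : Set ι)) q) := by
    intro t ht v hv
    rw [mem_openCluster_insert_rootEdge_iff ends h₂ (htx t ht)]
    exact ⟨fun h => h.resolve_left hv, fun h => Or.inr h⟩
  -- the two target summands
  set fRR : Finset ι → ℝ := fun t => (if (∀ z ∈ Z, z ∉ openCluster (ends '' (↑(t) : Set ι)) p ∧ z ∉ openCluster (ends '' (↑(t) : Set ι)) q) then (if (u ∈ openCluster (ends '' (↑(t) : Set ι)) p ∨ u ∈ openCluster (ends '' (↑(t) : Set ι)) q) then (1 : ℝ) else 0) * (if (w ∈ openCluster (ends '' (↑(t) : Set ι)) p ∨ w ∈ openCluster (ends '' (↑(t) : Set ι)) q) then (1 : ℝ) else 0) else 0) with hfRR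
  set fRB : Finset ι → ℝ := fun t => (if (∀ z ∈ Z, z ∉ openCluster (ends '' (↑(t) : Set ι)) p ∧ z ∉ openCluster (ends '' (↑(E' \ t) : Set ι)) q) then ((if u ∈ openCluster (ends '' (↑(t) : Set ι)) p then (1 : ℝ) else 0) - (if u ∈ openCluster (ends '' (↑(E' \ t) : Set ι)) q then (1 : ℝ) else 0)) * ((if w ∈ openCluster (ends '' (↑(t) : Set ι)) p then (1 : ℝ) else 0) - (if w ∈ openCluster (ends '' (↑(E' \ t) : Set ι)) q then (1 : ℝ) else 0)) else 0) with hfRB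
  -- indicator transport along an iff
  have indT : ∀ (P Q : Prop), (P ↔ Q) → (if P then (1 : ℝ) else 0) = (if Q then (1 : ℝ) else 0) :=
    fun P Q h => if_congr h rfl rfl
  have ind0 : ∀ (P : Prop), ¬ P → (if P then (1 : ℝ) else 0) = 0 := fun P hP => if_neg hP
  -- rewrite the left-hand side as a sum over `t ⊆ E'` of the four sector summands
  rw [Finset.sum_filter, hE, Finset.sum_powerset_insert he₁E'', Finset.sum_powerset_insert he₂E',
    Finset.sum_powerset_insert he₂E']
  -- sector BB (`s = t`)
  have sBB : ∀ t ∈ E'.powerset, (if (∀ z ∈ Z, z ∉ openCluster (ends '' (↑(t) : Set ι)) x ∧ z ∉ openCluster (ends '' (↑(insert e₁ (insert e₂ E') \ t) : Set ι)) x) then ((if u ∈ openCluster (ends '' (↑(t) : Set ι)) x then (1 : ℝ) else 0) - (if u ∈ openCluster (ends '' (↑(insert e₁ (insert e₂ E') \ t) : Set ι)) x then (1 : ℝ) else 0)) * ((if w ∈ openCluster (ends '' (↑(t) : Set ι)) x then (1 : ℝ) else 0) - (if w ∈ openCluster (ends '' (↑(insert e₁ (insert e₂ E') \ t) : Set ι))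 x then (1 : ℝ) else 0)) else 0) = fRR (E' \ t) := by
    intro t ht
    have htE : t ⊆ E' := Finset.mem_powerset.mp ht
    rw [cBB t htE, hfRR]
    dsimp only
    have hwall : (∀ z ∈ Z, z ∉ openCluster (ends '' (↑(t) : Set ι)) x ∧ z ∉ openCluster (ends '' (↑(insert e₁ (insert e₂ (E' \ t))) : Set ι)) x) ↔
        (∀ z ∈ Z, z ∉ openCluster (ends '' (↑(E' \ t) : Set ι)) p ∧ z ∉ openCluster (ends '' (↑(E' \ t) : Set ι)) q) := by
      constructor
      · intro h z hz
        have h2 := (h z hz).2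
        rw [kRR (E' \ t) (hsd t) z (hZx z hz)] at h2
        exact ⟨fun h' => h2 (Or.inl h'), fun h' => h2 (Or.inr h')⟩
      · intro h z hz
        refine ⟨k0 t htE z (hZx z hz), fun h' => ?_⟩
        rw [kRR (E' \ t) (hsd t) z (hZx z hz)] at h'
        exact h'.elim (h z hz).1 (h z hz).2
    by_cases hW : ∀ z ∈ Z, z ∉ openCluster (ends '' (↑(E' \ t) : Set ι)) p ∧ z ∉ openCluster (ends '' (↑(E' \ t) : Set ι)) q
    · rw [if_pos (hwall.mpr hW), if_pos hW, ind0 _ (k0 t htE u hux), ind0 _ (k0 t htE w hwx),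
        indT _ _ (kRR (E' \ t) (hsd t) u hux), indT _ _ (kRR (E' \ t) (hsd t) w hwx)]
      ring_nf
    · rw [if_neg (fun h => hW (hwall.mp h)), if_neg hW]
  -- sector BR (`s = insert e₂ t`)
  have sBR : ∀ t ∈ E'.powerset, (if (∀ z ∈ Z, z ∉ openCluster (ends '' (↑(insert e₂ t) : Set ι)) x ∧ z ∉ openCluster (ends '' (↑(insert e₁ (insert e₂ E') \ (insert e₂ t)) : Set ι)) x) then ((if u ∈ openCluster (ends '' (↑(insert e₂ t) : Set ι)) x then (1 : ℝ) else 0) - (if u ∈ openCluster (ends '' (↑(insert e₁ (insert e₂ E') \ (insert e₂ t)) : Set ι)) x then (1 : ℝ) else 0)) * ((if w ∈ openCluster (ends '' (↑(insert e₂ t) : Set ι)) x then (1 : ℝ) else 0) - (if w ∈ openCluster (ends '' (↑(insert e₁ (insert e₂ E') \ (insert e₂ t)) : Set ι)) x then (1 : ℝ) else 0)) else 0) = fRB (E' \ t) := by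
    intro t ht
    have htE : t ⊆ E' := Finset.mem_powerset.mp ht
    have hss : E' \ (E' \ t) = t := Finset.sdiff_sdiff_eq_self htE
    rw [cBR t htE, hfRB]
    dsimp only
    rw [hss]
    have hwall : (∀ z ∈ Z, z ∉ openCluster (ends '' (↑(insert e₂ t) : Set ι)) x ∧ z ∉ openCluster (ends '' (↑(insert e₁ (E' \ t)) : Set ι)) x) ↔
        (∀ z ∈ Z, z ∉ openCluster (ends '' (↑(E' \ t) : Set ι)) p ∧ z ∉ openCluster (ends '' (↑(t) : Set ι)) q) := by
      constructor
      · intro h z hz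
        obtain ⟨ha, hb⟩ := h z hz
        rw [kB t htE z (hZx z hz)] at ha
        rw [kR (E' \ t) (hsd t) z (hZx z hz)] at hb
        exact ⟨hb, ha⟩
      · intro h z hz
        obtain ⟨ha, hb⟩ := h z hz
        exact ⟨fun h' => hb ((kB t htE z (hZx z hz)).mp h'), fun h' => ha ((kR (E' \ t) (hsd t) z (hZx z hz)).mp h')⟩
    by_cases hW : ∀ z ∈ Z, z ∉ openCluster (ends '' (↑(E' \ t) : Set ι)) p ∧ z ∉ openCluster (ends '' (↑(t) : Set ι)) q
    · rw [if_pos (hwall.mpr hW), if_pos hW, indT _ _ (kB t htE u hux), indT _ _ (kB t htE w hwx),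
        indT _ _ (kR (E' \ t) (hsd t) u hux), indT _ _ (kR (E' \ t) (hsd t) w hwx)]
      ring_nf
    · rw [if_neg (fun h => hW (hwall.mp h)), if_neg hW]
  -- sector RB (`s = insert e₁ t`)
  have sRB : ∀ t ∈ E'.powerset, (if (∀ z ∈ Z, z ∉ openCluster (ends '' (↑(insert e₁ t) : Set ι)) x ∧ z ∉ openCluster (ends '' (↑(insert e₁ (insert e₂ E') \ (insert e₁ t)) : Set ι)) x) then ((if u ∈ openCluster (ends '' (↑(insert e₁ t) : Set ι)) x then (1 : ℝ) else 0) - (if u ∈ openCluster (ends '' (↑(insert e₁ (insert e₂ E') \ (insert e₁ t)) : Set ι)) x then (1 : ℝ) else 0)) * ((if w ∈ openCluster (ends '' (↑(insert e₁ t) : Set ι)) x then (1 : ℝ) else 0) - (if w ∈ openCluster (ends '' (↑(insert e₁ (insert e₂ E') \ (insert e₁ t)) : Set ι)) x then (1 : ℝ) else 0)) else 0) = fRB t := by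
    intro t ht
    have htE : t ⊆ E' := Finset.mem_powerset.mp ht
    rw [cRB t htE, hfRB]
    dsimp only
    have hwall : (∀ z ∈ Z, z ∉ openCluster (ends '' (↑(insert e₁ t) : Set ι)) x ∧ z ∉ openCluster (ends '' (↑(insert e₂ (E' \ t)) : Set ι)) x) ↔
        (∀ z ∈ Z, z ∉ openCluster (ends '' (↑(t) : Set ι)) p ∧ z ∉ openCluster (ends '' (↑(E' \ t) : Set ι)) q) := by
      constructor
      · intro h z hz
        obtain ⟨ha, hb⟩ := h z hz
        rw [kR t htE z (hZx z hz)] at ha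
        rw [kB (E' \ t) (hsd t) z (hZx z hz)] at hb
        exact ⟨ha, hb⟩
      · intro h z hz
        obtain ⟨ha, hb⟩ := h z hz
        exact ⟨fun h' => ha ((kR t htE z (hZx z hz)).mp h'), fun h' => hb ((kB (E' \ t) (hsd t) z (hZx z hz)).mp h')⟩
    by_cases hW : ∀ z ∈ Z, z ∉ openCluster (ends '' (↑(t) : Set ι)) p ∧ z ∉ openCluster (ends '' (↑(E' \ t) : Set ι)) q
    · rw [if_pos (hwall.mpr hW), if_pos hW, indT _ _ (kR t htE u hux), indT _ _ (kR t htE w hwx),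
        indT _ _ (kB (E' \ t) (hsd t) u hux), indT _ _ (kB (E' \ t) (hsd t) w hwx)]
    · rw [if_neg (fun h => hW (hwall.mp h)), if_neg hW]
  -- sector RR (`s = insert e₁ (insert e₂ t)`)
  have sRR : ∀ t ∈ E'.powerset, (if (∀ z ∈ Z, z ∉ openCluster (ends '' (↑(insert e₁ (insert e₂ t)) : Set ι)) x ∧ z ∉ openCluster (ends '' (↑(insert e₁ (insert e₂ E') \ (insert e₁ (insert e₂ t))) : Set ι)) x) then ((if u ∈ openCluster (ends '' (↑(insert e₁ (insert e₂ t)) : Set ι)) x then (1 : ℝ) else 0) - (if u ∈ openCluster (ends '' (↑(insert e₁ (insert e₂ E') \ (insert e₁ (insert e₂ t))) : Set ι)) x then (1 : ℝ) else 0)) * ((if w ∈ openCluster (ends '' (↑(insert e₁ (insert e₂ t)) : Set ι)) x then (1 : ℝ) else 0) - (if w ∈ openCluster (ends '' (↑(insert e₁ (insert e₂ E') \ (insert e₁ (insert e₂ t))) : Set ι)) x then (1 : ℝ) else 0)) else 0) = fRR t := by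
    intro t ht
    have htE : t ⊆ E' := Finset.mem_powerset.mp ht
    rw [cRR t htE, hfRR]
    dsimp only
    have hwall : (∀ z ∈ Z, z ∉ openCluster (ends '' (↑(insert e₁ (insert e₂ t)) : Set ι)) x ∧ z ∉ openCluster (ends '' (↑(E' \ t) : Set ι)) x) ↔
        (∀ z ∈ Z, z ∉ openCluster (ends '' (↑(t) : Set ι)) p ∧ z ∉ openCluster (ends '' (↑(t) : Set ι)) q) := by
      constructor
      · intro h z hz
        have h1 := (h z hz).1
        rw [kRR t htE z (hZx z hz)] at h1
        exact ⟨fun h' => h1 (Or.inl h'), fun h' => h1 (Or.inr h')⟩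
      · intro h z hz
        refine ⟨fun h' => ?_, k0 (E' \ t) (hsd t) z (hZx z hz)⟩
        rw [kRR t htE z (hZx z hz)] at h'
        exact h'.elim (h z hz).1 (h z hz).2
    by_cases hW : ∀ z ∈ Z, z ∉ openCluster (ends '' (↑(t) : Set ι)) p ∧ z ∉ openCluster (ends '' (↑(t) : Set ι)) q
    · rw [if_pos (hwall.mpr hW), if_pos hW, ind0 _ (k0 (E' \ t) (hsd t) u hux), ind0 _ (k0 (E' \ t) (hsd t) w hwx),
        indT _ _ (kRR t htE u hux), indT _ _ (kRR t htE w hwx)]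
      ring_nf
    · rw [if_neg (fun h => hW (hwall.mp h)), if_neg hW]
  rw [Finset.sum_congr rfl sBB, Finset.sum_congr rfl sBR, Finset.sum_congr rfl sRB, Finset.sum_congr rfl sRR]
  -- `t ↦ E' \ t` is an involution of `E'.powerset`
  have reflect : ∀ g : Finset ι → ℝ, ∑ t ∈ E'.powerset, g (E' \ t) = ∑ t ∈ E'.powerset, g t := by
    intro g
    refine Finset.sum_nbij' (fun t => E' \ t) (fun t => E' \ t) ?_ ?_ ?_ ?_ ?_
    · exact fun t _ => Finset.mem_powerset.mpr Finset.sdiff_subset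
    · exact fun t _ => Finset.mem_powerset.mpr Finset.sdiff_subset
    exacts [fun t ht => Finset.sdiff_sdiff_eq_self (Finset.mem_powerset.mp ht),
      fun t ht => Finset.sdiff_sdiff_eq_self (Finset.mem_powerset.mp ht), fun t _ => rfl]
  rw [reflect fRR, reflect fRB, Finset.sum_filter, Finset.sum_filter]
  have eRR : ∑ t ∈ E'.powerset, fRR t = ∑ t ∈ E'.powerset, (if (∀ z ∈ Z, z ∉ openCluster (ends '' (↑(t) : Set ι)) p ∧ z ∉ openCluster (ends '' (↑(t) : Set ι)) q) then (if (u ∈ openCluster (ends '' (↑(t) : Set ι)) p ∨ u ∈ openCluster (ends '' (↑(t) : Set ι)) q) then (1 : ℝ) else 0) * (if (w ∈ openCluster (ends '' (↑(t) : Set ι)) p ∨ w ∈ openCluster (ends '' (↑(t) : Set ι)) q) then (1 : ℝ) else 0) else 0) := rfl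
  have eRB : ∑ t ∈ E'.powerset, fRB t = ∑ t ∈ E'.powerset, (if (∀ z ∈ Z, z ∉ openCluster (ends '' (↑(t) : Set ι)) p ∧ z ∉ openCluster (ends '' (↑(E' \ t) : Set ι)) q) then ((if u ∈ openCluster (ends '' (↑(t) : Set ι)) p then (1 : ℝ) else 0) - (if u ∈ openCluster (ends '' (↑(E' \ t) : Set ι)) q then (1 : ℝ) else 0)) * ((if w ∈ openCluster (ends '' (↑(t) : Set ι)) p then (1 : ℝ) else 0) - (if w ∈ openCluster (ends '' (↑(E' \ t) : Set ι)) q then (1 : ℝ) else 0)) else 0) := rfl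
  rw [eRR, eRB]
  ring

open Classical in
/-- **COROLLARY: the two-source inequality on `H = G − x` gives the point row at a root of degree two.**  With the notation of
`pointRow_rootDegTwo_eq`: if `0 ≤ N_pure + M` (`N_pure` = number of colourings of `E'` with `u, w` red-joined to `{p,q}` and `Z` not; `M` = concordant minus
crossing colourings of the mixed sector, red cluster of `p` against blue cluster of `q`), then `0 ≤ Σ_{W_E} σ_u σ_w`.  This is the reduction behind conjectures
(C2′)/V1 of CW-SECTORS-gen37 §0(viii): a proof of `N_pure + conc ≥ cross` for two-source colourings closes the point row at every root of degree two.
[cite: KozmaNitzan2024, Questions 8–9 (§5.5 p. 36) (context)] -/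
theorem pointRow_nonneg_of_rootDegTwo (E : Finset ι) {x p q : V} {e₁ e₂ : ι} (he₁ : e₁ ∈ E) (he₂ : e₂ ∈ E) (hne : e₁ ≠ e₂)
    (h₁ : ends e₁ = s(x, p)) (h₂ : ends e₂ = s(x, q)) (hroot : ∀ i ∈ E, x ∈ ends i → i = e₁ ∨ i = e₂)
    (u w : V) (hux : u ≠ x) (hwx : w ≠ x) (Z : Set V) (hxZ : x ∉ Z)
    (hH : 0 ≤ (∑ t ∈ ((E.erase e₁).erase e₂).powerset.filter (fun t : Finset ι => ∀ z ∈ Z,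
          z ∉ openCluster (ends '' (↑(t) : Set ι)) p ∧ z ∉ openCluster (ends '' (↑(t) : Set ι)) q),
      (if (u ∈ openCluster (ends '' (↑(t) : Set ι)) p ∨ u ∈ openCluster (ends '' (↑(t) : Set ι)) q) then (1 : ℝ) else 0) *
        (if (w ∈ openCluster (ends '' (↑(t) : Set ι)) p ∨ w ∈ openCluster (ends '' (↑(t) : Set ι)) q) then (1 : ℝ) else 0)) +
    (∑ t ∈ ((E.erase e₁).erase e₂).powerset.filter (fun t : Finset ι => ∀ z ∈ Z,
          z ∉ openCluster (ends '' (↑(t) : Set ι)) p ∧ z ∉ openCluster (ends '' (↑(((E.erase e₁).erase e₂) \ t) : Set ι)) q),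
      ((if u ∈ openCluster (ends '' (↑(t) : Set ι)) p then (1 : ℝ) else 0) -
          (if u ∈ openCluster (ends '' (↑(((E.erase e₁).erase e₂) \ t) : Set ι)) q then (1 : ℝ) else 0)) *
        ((if w ∈ openCluster (ends '' (↑(t) : Set ι)) p then (1 : ℝ) else 0) -
          (if w ∈ openCluster (ends '' (↑(((E.erase e₁).erase e₂) \ t) : Set ι)) q then (1 : ℝ) else 0)))) :
    0 ≤ ∑ s ∈ E.powerset.filter (fun s : Finset ι => ∀ z ∈ Z, z ∉ openCluster (ends '' (↑(s) : Set ι)) x ∧ z ∉ openCluster (ends '' (↑(E \ s) : Set ι)) x),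
      ((if u ∈ openCluster (ends '' (↑(s) : Set ι)) x then (1 : ℝ) else 0) - (if u ∈ openCluster (ends '' (↑(E \ s) : Set ι)) x then (1 : ℝ) else 0)) *
        ((if w ∈ openCluster (ends '' (↑(s) : Set ι)) x then (1 : ℝ) else 0) - (if w ∈ openCluster (ends '' (↑(E \ s) : Set ι)) x then (1 : ℝ) else 0)) := by
  rw [pointRow_rootDegTwo_eq ends E he₁ he₂ hne h₁ h₂ hroot u w hux hwx Z hxZ]
  linarith

end sums

end Coefficientwise

end Summit.CriticalPhenomena.PercolationContinuityZ3.Theorems
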